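import Summits.Ventures.FusionMHD.Bench.SolovevPCFIterMercierEdgeIntegrals1
import HarnessLib

/-!
# F1 / MERCIER at the ITER-like PCF edge — KERNEL BRIDGE 3/4: the `t`-integrals `∫w/G`, `∫w/(uG)`, `∫w/u`,
# `∫uw/(g²+G)`, `∫uw/((g²+G)G)` equal rational multiples of the certified `K₆, K₇, K₄, KY(g), KX(g)`
(venture LADDER-GRIDFUSION, rung F1.MERCIER-profile; cell `gridfusion`, seat `gridfusion-sos-6` (g3), 2026-08-27; see
`…MercierEdgeSubst` for the purpose of the series.)

`T5: ∫₀^{2π} w/G = (κ₀/(c·4αρ²))K₆`, `T6a: ∫₀^{2π} w/(uG) = (κ₀/(c·4αρ²))K₇`, `T6b: ∫₀^{2π} w/u = (κ₀/c)K₄`,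
`T7: ∫₀^{2π} uw/(g² + G) = (κ₀/c)KY(g)`, `T8: ∫₀^{2π} uw/((g² + G)G) = (κ₀/(cg²))KX(g)` (`g > 0`; `KX, KY` are the honest
`g`-dependent integrals of `…MercierEdgeAverages`, whose certified content is the uniform bounds `KX ≤ K₈/(4αρ²)`,
`KY ≤ K₅/g²`).  Same method as file 2/4; the only extra algebra is `u/√u = √u` (set `s := √U_σ`, `U_σ = s²`).
HONEST FRAMING (LADDER-GRIDFUSION three columns, never merged): CERTIFIED = kernel identities/inequalities about the MODEL's
edge surface (ideal MHD, axisymmetric, Solov'ev profiles `μ₀p′ = −1`, `FF′ = 0`, analytic fixed-boundary PCF equilibrium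
[cite: PatakiCerfonFreidberg2013, §6.1], free constant `F = RB_φ` a parameter); VALIDATED cross-checks live in
`pub/gridfusion/cert/F/mercier-dm-validated.md`; Mercier/GGJ is a NECESSARY (local interchange) criterion; nothing here says
any plasma or device is stable. No `native_decide`; no `decide` in this file (the enclosures are the imported Data files').
-/

noncomputable section

open Real MeasureTheory Set intervalIntegral
open Literature.Analysis.ValidatedNumerics Literature.Analysis.ValidatedNumerics.PolyMP
open Literature.Analysis.ValidatedNumerics.ExpPoly (Poly)
open Literature.MathematicalPhysics.MHD Literature.MathematicalPhysics.MHD.Solovev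
open Summit.Ventures.FusionMHD.Models.SolovevPCF

namespace Summit.Ventures.FusionMHD.Bench.SolovevPCFIter.MercierEdge

section atomic

variable {g : ℝ} (hg : 0 < g)
include hg

/-- `T5`: `∫₀^{2π} w/G dt = (κ₀/(c·4αρ²))·K₆`. [folklore] -/
theorem integral_w_div_G_edge :
    ∫ t in (0 : ℝ)..(2 * π), lcAvgWeight IterLike.kappa0 g IterLike.Ra (IterLike.q0 g) (IterLike.ε / IterLike.Ra) t
        / lcGradSq IterLike.kappa0 g IterLike.Ra (IterLike.q0 g) (IterLike.ε / IterLike.Ra) t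
      = IterLike.kappa0 / ((2257675225 / 6032287802 : ℝ) * c4) * K6 := by
  have hg' := hg.ne'
  have hc : Continuous fun t =>
      lcAvgWeight IterLike.kappa0 g IterLike.Ra (IterLike.q0 g) (IterLike.ε / IterLike.Ra) t
        / lcGradSq IterLike.kappa0 g IterLike.Ra (IterLike.q0 g) (IterLike.ε / IterLike.Ra) t :=
    (continuous_w_edge hg).div₀ continuous_lcGradSq_edge fun t => (lcGradSq_edge_pos hg t).ne'
  rw [integral_zero_two_pi_eq_theta _ hc
    (fun t => by simp only [lcAvgWeight_edge hg', lcU_two_pi_sub, lcGradSq_two_pi_sub hg'])]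
  have key : ∀ w ∈ uIcc (0:ℝ) 1,
      (lcAvgWeight IterLike.kappa0 g IterLike.Ra (IterLike.q0 g) (IterLike.ε / IterLike.Ra) (theta w)
          / lcGradSq IterLike.kappa0 g IterLike.Ra (IterLike.q0 g) (IterLike.ε / IterLike.Ra) (theta w)
        + lcAvgWeight IterLike.kappa0 g IterLike.Ra (IterLike.q0 g) (IterLike.ε / IterLike.Ra) (π - theta w)
          / lcGradSq IterLike.kappa0 g IterLike.Ra (IterLike.q0 g) (IterLike.ε / IterLike.Ra) (π - theta w))
        * (2 / Real.sqrt (2 - w ^ 2))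
      = IterLike.kappa0 / (2 * (2257675225 / 6032287802 : ℝ) * c4) * (K6e.toFun w * Poly.eval [2] w) := by
    intro w hw
    rw [uIcc01] at hw
    rw [lcAvgWeight_edge hg', lcAvgWeight_edge hg', lcGradSq_theta hg' hw, lcGradSq_pi_sub_theta hg' hw,
      lcU_theta hw, lcU_pi_sub_theta hw, toFun_K6e, eval_const_two]
    have hP1 : Pplus w ≠ 0 := (Pplus_pos hw).ne'
    have hP2 : Pminus w ≠ 0 := (Pminus_pos hw).ne'
    have h5 : Real.sqrt (2 - w ^ 2) ≠ 0 := (sqrt_two_sub_pos hw).ne'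
    have hc4 : c4 ≠ 0 := c4_pos.ne'
    set s1 := Real.sqrt (Uplus w) with hs1
    set s2 := Real.sqrt (Uminus w) with hs2
    have hU1 : Uplus w = s1 ^ 2 := by rw [hs1, Real.sq_sqrt (Uplus_pos hw).le]
    have hU2 : Uminus w = s2 ^ 2 := by rw [hs2, Real.sq_sqrt (Uminus_pos w).le]
    have hs1' : s1 ≠ 0 := by rw [hs1]; exact (Real.sqrt_pos.2 (Uplus_pos hw)).ne'
    have hs2' : s2 ≠ 0 := by rw [hs2]; exact (Real.sqrt_pos.2 (Uminus_pos w)).ne'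
    rw [hU1, hU2]
    field_simp
  rw [integral_congr key, intervalIntegral.integral_const_mul]
  unfold K6
  ring

/-- Continuity of `w/(uG)`. [folklore] -/
theorem continuous_w_div_uG_edge : Continuous fun t =>
      lcAvgWeight IterLike.kappa0 g IterLike.Ra (IterLike.q0 g) (IterLike.ε / IterLike.Ra) t
        / (lcU IterLike.Ra (IterLike.ε / IterLike.Ra) t
            * lcGradSq IterLike.kappa0 g IterLike.Ra (IterLike.q0 g) (IterLike.ε / IterLike.Ra) t) :=
  (continuous_w_edge hg).div₀ (continuous_lcU_edge.mul continuous_lcGradSq_edge)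
    fun t => mul_ne_zero (lcU_edge_pos t).ne' (lcGradSq_edge_pos hg t).ne'

/-- Continuity of `w/u`. [folklore] -/
theorem continuous_w_div_u_edge : Continuous fun t =>
      lcAvgWeight IterLike.kappa0 g IterLike.Ra (IterLike.q0 g) (IterLike.ε / IterLike.Ra) t
        / lcU IterLike.Ra (IterLike.ε / IterLike.Ra) t :=
  (continuous_w_edge hg).div₀ continuous_lcU_edge fun t => (lcU_edge_pos t).ne'

/-- `T6a`: `∫₀^{2π} w/(uG) dt = (κ₀/(c·4αρ²))·K₇`. [folklore] -/
theorem integral_w_div_uG_edge :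
    ∫ t in (0 : ℝ)..(2 * π), lcAvgWeight IterLike.kappa0 g IterLike.Ra (IterLike.q0 g) (IterLike.ε / IterLike.Ra) t
        / (lcU IterLike.Ra (IterLike.ε / IterLike.Ra) t
            * lcGradSq IterLike.kappa0 g IterLike.Ra (IterLike.q0 g) (IterLike.ε / IterLike.Ra) t)
      = IterLike.kappa0 / ((2257675225 / 6032287802 : ℝ) * c4) * K7 := by
  have hg' := hg.ne'
  rw [integral_zero_two_pi_eq_theta _ (continuous_w_div_uG_edge hg)
    (fun t => by simp only [lcAvgWeight_edge hg', lcU_two_pi_sub, lcGradSq_two_pi_sub hg'])]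
  have key : ∀ w ∈ uIcc (0:ℝ) 1,
      (lcAvgWeight IterLike.kappa0 g IterLike.Ra (IterLike.q0 g) (IterLike.ε / IterLike.Ra) (theta w)
          / (lcU IterLike.Ra (IterLike.ε / IterLike.Ra) (theta w)
              * lcGradSq IterLike.kappa0 g IterLike.Ra (IterLike.q0 g) (IterLike.ε / IterLike.Ra) (theta w))
        + lcAvgWeight IterLike.kappa0 g IterLike.Ra (IterLike.q0 g) (IterLike.ε / IterLike.Ra) (π - theta w)
          / (lcU IterLike.Ra (IterLike.ε / IterLike.Ra) (π - theta w)
              * lcGradSq IterLike.kappa0 g IterLike.Ra (IterLike.q0 g) (IterLike.ε / IterLike.Ra) (π - theta w)))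
        * (2 / Real.sqrt (2 - w ^ 2))
      = IterLike.kappa0 / (2 * (2257675225 / 6032287802 : ℝ) * c4) * (K7e.toFun w * Poly.eval [2] w) := by
    intro w hw
    rw [uIcc01] at hw
    rw [lcAvgWeight_edge hg', lcAvgWeight_edge hg', lcGradSq_theta hg' hw, lcGradSq_pi_sub_theta hg' hw,
      lcU_theta hw, lcU_pi_sub_theta hw, toFun_K7e, eval_const_two]
    have hP1 : Pplus w ≠ 0 := (Pplus_pos hw).ne'
    have hP2 : Pminus w ≠ 0 := (Pminus_pos hw).ne'
    have hU1 : Uplus w ≠ 0 := (Uplus_pos hw).ne'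
    have hU2 : Uminus w ≠ 0 := (Uminus_pos w).ne'
    have h3 : Real.sqrt (Uplus w) ≠ 0 := (Real.sqrt_pos.2 (Uplus_pos hw)).ne'
    have h4 : Real.sqrt (Uminus w) ≠ 0 := (Real.sqrt_pos.2 (Uminus_pos w)).ne'
    have h5 : Real.sqrt (2 - w ^ 2) ≠ 0 := (sqrt_two_sub_pos hw).ne'
    have hc4 : c4 ≠ 0 := c4_pos.ne'
    field_simp
  rw [integral_congr key, intervalIntegral.integral_const_mul]
  unfold K7
  ring

/-- `T6b`: `∫₀^{2π} w/u dt = (κ₀/c)·K₄`. [folklore] -/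
theorem integral_w_div_u_edge :
    ∫ t in (0 : ℝ)..(2 * π), lcAvgWeight IterLike.kappa0 g IterLike.Ra (IterLike.q0 g) (IterLike.ε / IterLike.Ra) t
        / lcU IterLike.Ra (IterLike.ε / IterLike.Ra) t
      = IterLike.kappa0 / (2257675225 / 6032287802 : ℝ) * K4 := by
  have hg' := hg.ne'
  rw [integral_zero_two_pi_eq_theta _ (continuous_w_div_u_edge hg)
    (fun t => by simp only [lcAvgWeight_edge hg', lcU_two_pi_sub])]
  have key : ∀ w ∈ uIcc (0:ℝ) 1,
      (lcAvgWeight IterLike.kappa0 g IterLike.Ra (IterLike.q0 g) (IterLike.ε / IterLike.Ra) (theta w)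
          / lcU IterLike.Ra (IterLike.ε / IterLike.Ra) (theta w)
        + lcAvgWeight IterLike.kappa0 g IterLike.Ra (IterLike.q0 g) (IterLike.ε / IterLike.Ra) (π - theta w)
          / lcU IterLike.Ra (IterLike.ε / IterLike.Ra) (π - theta w))
        * (2 / Real.sqrt (2 - w ^ 2))
      = IterLike.kappa0 / (2 * (2257675225 / 6032287802 : ℝ)) * (edgeIntegrand.toFun w * Poly.eval [2] w) := by
    intro w hw
    rw [uIcc01] at hw
    rw [lcAvgWeight_edge hg', lcAvgWeight_edge hg', lcU_theta hw, lcU_pi_sub_theta hw, toFun_edgeIntegrand,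
      eval_const_two]
    have hU1 : Uplus w ≠ 0 := (Uplus_pos hw).ne'
    have hU2 : Uminus w ≠ 0 := (Uminus_pos w).ne'
    have h3 : Real.sqrt (Uplus w) ≠ 0 := (Real.sqrt_pos.2 (Uplus_pos hw)).ne'
    have h4 : Real.sqrt (Uminus w) ≠ 0 := (Real.sqrt_pos.2 (Uminus_pos w)).ne'
    have h5 : Real.sqrt (2 - w ^ 2) ≠ 0 := (sqrt_two_sub_pos hw).ne'
    field_simp
  rw [integral_congr key, intervalIntegral.integral_const_mul]
  unfold K4 edgeI
  ring

/-- `T7`: `∫₀^{2π} u·w/(g² + G) dt = (κ₀/c)·KY(g)`. [folklore] -/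
theorem integral_invBsq_edge :
    ∫ t in (0 : ℝ)..(2 * π), lcU IterLike.Ra (IterLike.ε / IterLike.Ra) t
        / (g ^ 2 + lcGradSq IterLike.kappa0 g IterLike.Ra (IterLike.q0 g) (IterLike.ε / IterLike.Ra) t)
        * lcAvgWeight IterLike.kappa0 g IterLike.Ra (IterLike.q0 g) (IterLike.ε / IterLike.Ra) t
      = IterLike.kappa0 / (2257675225 / 6032287802 : ℝ) * KY g := by
  have hg' := hg.ne'
  have hpos : ∀ t, 0 < g ^ 2 + lcGradSq IterLike.kappa0 g IterLike.Ra (IterLike.q0 g) (IterLike.ε / IterLike.Ra) t :=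
    fun t => add_pos (pow_pos hg 2) (lcGradSq_edge_pos hg t)
  have hc : Continuous fun t => lcU IterLike.Ra (IterLike.ε / IterLike.Ra) t
        / (g ^ 2 + lcGradSq IterLike.kappa0 g IterLike.Ra (IterLike.q0 g) (IterLike.ε / IterLike.Ra) t)
        * lcAvgWeight IterLike.kappa0 g IterLike.Ra (IterLike.q0 g) (IterLike.ε / IterLike.Ra) t :=
    (continuous_lcU_edge.div₀ (continuous_const.add continuous_lcGradSq_edge)
      fun t => (hpos t).ne').mul (continuous_w_edge hg)
  rw [integral_zero_two_pi_eq_theta _ hc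
    (fun t => by simp only [lcAvgWeight_edge hg', lcU_two_pi_sub, lcGradSq_two_pi_sub hg'])]
  have key : ∀ w ∈ uIcc (0:ℝ) 1,
      (lcU IterLike.Ra (IterLike.ε / IterLike.Ra) (theta w)
          / (g ^ 2 + lcGradSq IterLike.kappa0 g IterLike.Ra (IterLike.q0 g) (IterLike.ε / IterLike.Ra) (theta w))
          * lcAvgWeight IterLike.kappa0 g IterLike.Ra (IterLike.q0 g) (IterLike.ε / IterLike.Ra) (theta w)
        + lcU IterLike.Ra (IterLike.ε / IterLike.Ra) (π - theta w)
          / (g ^ 2 + lcGradSq IterLike.kappa0 g IterLike.Ra (IterLike.q0 g) (IterLike.ε / IterLike.Ra) (π - theta w))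
          * lcAvgWeight IterLike.kappa0 g IterLike.Ra (IterLike.q0 g) (IterLike.ε / IterLike.Ra) (π - theta w))
        * (2 / Real.sqrt (2 - w ^ 2))
      = IterLike.kappa0 / (2 * (2257675225 / 6032287802 : ℝ)) * yfun g w := by
    intro w hw
    rw [uIcc01] at hw
    rw [lcAvgWeight_edge hg', lcAvgWeight_edge hg', lcGradSq_theta hg' hw, lcGradSq_pi_sub_theta hg' hw,
      lcU_theta hw, lcU_pi_sub_theta hw]
    unfold yfun
    have hP1 : 0 < Pplus w := Pplus_pos hw
    have hP2 : 0 < Pminus w := Pminus_pos hw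
    have h5 : Real.sqrt (2 - w ^ 2) ≠ 0 := (sqrt_two_sub_pos hw).ne'
    have hc4 : 0 < c4 := c4_pos
    set s1 := Real.sqrt (Uplus w) with hs1
    set s2 := Real.sqrt (Uminus w) with hs2
    have hU1 : Uplus w = s1 ^ 2 := by rw [hs1, Real.sq_sqrt (Uplus_pos hw).le]
    have hU2 : Uminus w = s2 ^ 2 := by rw [hs2, Real.sq_sqrt (Uminus_pos w).le]
    have hs1' : 0 < s1 := by rw [hs1]; exact Real.sqrt_pos.2 (Uplus_pos hw)
    have hs2' : 0 < s2 := by rw [hs2]; exact Real.sqrt_pos.2 (Uminus_pos w)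
    rw [hU1, hU2]
    have hd1 : g ^ 2 * s1 ^ 2 + c4 * Pplus w ≠ 0 := by positivity
    have hd2 : g ^ 2 * s2 ^ 2 + c4 * Pminus w ≠ 0 := by positivity
    have hd3 : g ^ 2 + c4 * Pplus w / s1 ^ 2 ≠ 0 := by positivity
    have hd4 : g ^ 2 + c4 * Pminus w / s2 ^ 2 ≠ 0 := by positivity
    field_simp
  rw [integral_congr key, intervalIntegral.integral_const_mul]
  unfold KY
  ring

/-- `T8`: `∫₀^{2π} u·w/((g² + G)G) dt = (κ₀/(c g²))·KX(g)`. [folklore] -/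
theorem integral_invBsqGradSq_edge :
    ∫ t in (0 : ℝ)..(2 * π), lcU IterLike.Ra (IterLike.ε / IterLike.Ra) t
        / ((g ^ 2 + lcGradSq IterLike.kappa0 g IterLike.Ra (IterLike.q0 g) (IterLike.ε / IterLike.Ra) t)
            * lcGradSq IterLike.kappa0 g IterLike.Ra (IterLike.q0 g) (IterLike.ε / IterLike.Ra) t)
        * lcAvgWeight IterLike.kappa0 g IterLike.Ra (IterLike.q0 g) (IterLike.ε / IterLike.Ra) t
      = IterLike.kappa0 / ((2257675225 / 6032287802 : ℝ) * g ^ 2) * KX g := by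
  have hg' := hg.ne'
  have hpos : ∀ t, 0 < g ^ 2 + lcGradSq IterLike.kappa0 g IterLike.Ra (IterLike.q0 g) (IterLike.ε / IterLike.Ra) t :=
    fun t => add_pos (pow_pos hg 2) (lcGradSq_edge_pos hg t)
  have hc : Continuous fun t => lcU IterLike.Ra (IterLike.ε / IterLike.Ra) t
        / ((g ^ 2 + lcGradSq IterLike.kappa0 g IterLike.Ra (IterLike.q0 g) (IterLike.ε / IterLike.Ra) t)
            * lcGradSq IterLike.kappa0 g IterLike.Ra (IterLike.q0 g) (IterLike.ε / IterLike.Ra) t)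
        * lcAvgWeight IterLike.kappa0 g IterLike.Ra (IterLike.q0 g) (IterLike.ε / IterLike.Ra) t :=
    (continuous_lcU_edge.div₀ ((continuous_const.add continuous_lcGradSq_edge).mul
      continuous_lcGradSq_edge) fun t => mul_ne_zero (hpos t).ne' (lcGradSq_edge_pos hg t).ne').mul
      (continuous_w_edge hg)
  rw [integral_zero_two_pi_eq_theta _ hc
    (fun t => by simp only [lcAvgWeight_edge hg', lcU_two_pi_sub, lcGradSq_two_pi_sub hg'])]
  have key : ∀ w ∈ uIcc (0:ℝ) 1,
      (lcU IterLike.Ra (IterLike.ε / IterLike.Ra) (theta w)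
          / ((g ^ 2 + lcGradSq IterLike.kappa0 g IterLike.Ra (IterLike.q0 g) (IterLike.ε / IterLike.Ra) (theta w))
              * lcGradSq IterLike.kappa0 g IterLike.Ra (IterLike.q0 g) (IterLike.ε / IterLike.Ra) (theta w))
          * lcAvgWeight IterLike.kappa0 g IterLike.Ra (IterLike.q0 g) (IterLike.ε / IterLike.Ra) (theta w)
        + lcU IterLike.Ra (IterLike.ε / IterLike.Ra) (π - theta w)
          / ((g ^ 2 + lcGradSq IterLike.kappa0 g IterLike.Ra (IterLike.q0 g) (IterLike.ε / IterLike.Ra) (π - theta w))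
              * lcGradSq IterLike.kappa0 g IterLike.Ra (IterLike.q0 g) (IterLike.ε / IterLike.Ra) (π - theta w))
          * lcAvgWeight IterLike.kappa0 g IterLike.Ra (IterLike.q0 g) (IterLike.ε / IterLike.Ra) (π - theta w))
        * (2 / Real.sqrt (2 - w ^ 2))
      = IterLike.kappa0 / (2 * (2257675225 / 6032287802 : ℝ) * g ^ 2) * xfun g w := by
    intro w hw
    rw [uIcc01] at hw
    rw [lcAvgWeight_edge hg', lcAvgWeight_edge hg', lcGradSq_theta hg' hw, lcGradSq_pi_sub_theta hg' hw,
      lcU_theta hw, lcU_pi_sub_theta hw]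
    unfold xfun
    have hP1 : 0 < Pplus w := Pplus_pos hw
    have hP2 : 0 < Pminus w := Pminus_pos hw
    have h5 : Real.sqrt (2 - w ^ 2) ≠ 0 := (sqrt_two_sub_pos hw).ne'
    have hc4 : 0 < c4 := c4_pos
    set s1 := Real.sqrt (Uplus w) with hs1
    set s2 := Real.sqrt (Uminus w) with hs2
    have hU1 : Uplus w = s1 ^ 2 := by rw [hs1, Real.sq_sqrt (Uplus_pos hw).le]
    have hU2 : Uminus w = s2 ^ 2 := by rw [hs2, Real.sq_sqrt (Uminus_pos w).le]
    have hs1' : 0 < s1 := by rw [hs1]; exact Real.sqrt_pos.2 (Uplus_pos hw)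
    have hs2' : 0 < s2 := by rw [hs2]; exact Real.sqrt_pos.2 (Uminus_pos w)
    rw [hU1, hU2]
    have hd1 : g ^ 2 * s1 ^ 2 + c4 * Pplus w ≠ 0 := by positivity
    have hd2 : g ^ 2 * s2 ^ 2 + c4 * Pminus w ≠ 0 := by positivity
    have hd3 : g ^ 2 + c4 * Pplus w / s1 ^ 2 ≠ 0 := by positivity
    have hd4 : g ^ 2 + c4 * Pminus w / s2 ^ 2 ≠ 0 := by positivity
    field_simp
  rw [integral_congr key, intervalIntegral.integral_const_mul]
  unfold KX
  ring

end atomic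

end Summit.Ventures.FusionMHD.Bench.SolovevPCFIter.MercierEdge

end
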